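import Summits.Ventures.PercRepro.ProfilePointedCircuitClassesTwelve

/-!
# PercRepro — THE CO-RANK-6 TOP THRESHOLD AT NULLITY 5 ON TWELVE POINTS, UNCONDITIONALLY, II: THE CHAIN (p5, gen 40;
`proofs/P5-GM1.md` §59 ADDENDUM 2)

The chain of `…FiveTop` re-run on `#E = 12`, `ρ(E) = 7` with `gammaC_five_le_of_card_eq_two_of_twelve` in the class
`#C = 2`: `gammaC_five_le_of_nullity_five_of_twelve`, `capCount_five_le_of_twelve`, `outCount_five_le_inCount_six_of_twelve`,
**`biIndep_step_five_of_twelve`** (`7·P_5 ≤ 6·P_6` — THEOREM A'S STEP AT THE LEVEL `5`, the first unconditional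
level-`5` bottom step of nullity `5`) and **`thresholdIneq_six_top_of_twelve`** (`ThresholdIneq N 6 6`: the co-rank-`6`
top threshold at nullity `5` on twelve points).
-/

open scoped Matroid

namespace PercRepro.Cogirth

open Finset ThmH Skew Shadow Profile

variable {α : Type} [DecidableEq α] {N : Matroid α} [N.Finite]

section TwelveTop

/-- Every circuit class of a `12`-point matroid of rank `7` has at least as many captured sets at the level `6` as at
the level `5` (the case split of `gammaC_five_le_of_nullity_five_of_inout`, the class `#C = 2` now unconditional). -/
theorem gammaC_five_le_of_nullity_five_of_twelve (hn : (gr N).card = rk N (gr N) + 5) (hR7 : rk N (gr N) = 7)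
    (x : α) (C : Finset α) : gammaC N 5 x C ≤ gammaC N ((gr N).card - 6) x C := by
  have hR : 7 ≤ rk N (gr N) := hR7.ge
  rcases Nat.lt_or_ge 5 C.card with h6 | h5
  · rw [gammaC_eq_zero_of_lt_card h6]
    exact Nat.zero_le _
  · by_cases hx : x ∈ gr N
    · interval_cases hc : C.card
      · rw [gammaC_eq_zero_of_card_eq_zero hc (by norm_num) hx]
        exact Nat.zero_le _
      · exact gammaC_five_le_of_card_eq_one hn hR x hc
      · exact gammaC_five_le_of_card_eq_two_of_twelve hn hR7 x hc
      · exact gammaC_five_le_of_card_eq_three hn hR x hc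
      · exact gammaC_five_le_of_card_eq_four hn hR x hc
      · exact gammaC_five_le_of_card_eq_five hn hR x hc
    · have h0 : gammaC N 5 x C = 0 := by
        unfold gammaC
        rw [card_eq_zero, filter_eq_empty_iff]
        intro W _ hWC
        exact hx (clF_subset_gr W hWC.2.1)
      rw [h0]
      exact Nat.zero_le _

/-- `κ_5(x) ≤ κ_6(x)` on `#E = 12`, `ρ(E) = 7`. -/
theorem capCount_five_le_of_twelve (hn : (gr N).card = rk N (gr N) + 5) (hR7 : rk N (gr N) = 7) (x : α) :
    capCount N 5 x ≤ capCount N ((gr N).card - 6) x := by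
  rw [capCount_eq_sum_gammaC, capCount_eq_sum_gammaC]
  exact sum_le_sum (fun C _ => gammaC_five_le_of_nullity_five_of_twelve hn hR7 x C)

/-- `out_5(x) ≤ in_6(x)` on `#E = 12`, `ρ(E) = 7`. -/
theorem outCount_five_le_inCount_six_of_twelve (hn : (gr N).card = rk N (gr N) + 5) (hR7 : rk N (gr N) = 7)
    {x : α} (hx : x ∈ gr N) : outCount N 5 x ≤ inCount N 6 x := by
  have h := outCount_add_capCount_mirror (M := N) 5 hx (by omega)
  have h2 := capCount_five_le_of_twelve hn hR7 x
  norm_num at h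
  omega

/-- **THEOREM A'S STEP AT THE LEVEL `5` ON EVERY MATROID WITH `#E = 12`, `ρ(E) = 7`**: `7·P_5 ≤ 6·P_6` — the first
unconditional instance of the level-`5` bottom step of nullity `5`. -/
theorem biIndep_step_five_of_twelve (hn : (gr N).card = rk N (gr N) + 5) (hR7 : rk N (gr N) = 7) :
    ((gr N).card - 5) * (biIndepSets N 5).card ≤ 6 * (biIndepSets N 6).card := by
  rw [← sum_outCount, ← sum_inCount]
  exact sum_le_sum (fun x hx => outCount_five_le_inCount_six_of_twelve hn hR7 hx)

/-- **THE CO-RANK-6 TOP THRESHOLD AT NULLITY 5 ON TWELVE POINTS**: `ThresholdIneq N 6 (ρ(E) − 1)` on `#E = 12`,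
`ρ(E) = 7`, unconditionally. -/
theorem thresholdIneq_six_top_of_twelve (hn : (gr N).card = rk N (gr N) + 5) (hR7 : rk N (gr N) = 7) :
    ThresholdIneq N 6 (rk N (gr N) - 1) := by
  have hn' : (gr N).card = (rk N (gr N) - 1) + 6 := by omega
  unfold ThresholdIneq
  rw [thresholdSum_of_card_eq hn' (by norm_num), levelSetCoQ_eq_biIndepSets_of_card_eq hn']
  have h := biIndep_step_five_of_twelve hn hR7
  have e1 : (gr N).card - 5 = (rk N (gr N) - 1) + 1 := by omega
  rw [e1] at h
  exact h

end TwelveTop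

end PercRepro.Cogirth
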